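import Literature.NumberTheory.LFunctions.BilinearKloostermanSumsPrimeModulus
import Literature.NumberTheory.GaussSums.GaussSumMonomialFourier

/-!
# Bilinear forms with HYPER-Kloosterman sums `Kl_k`, every rank `k ≥ 2`, to one prime modulus:
# Kowalski–Michel–Sawin 2017, Theorems 1.1 and 1.3 AS PRINTED (the `k ≥ 3` form left as a TODO in
# `BilinearKloostermanSumsPrimeModulus.lean`, now sayable over the tree's `GaussSums.hyperKloosterman`)

E. Kowalski, Ph. Michel, W. Sawin, *Bilinear forms with Kloosterman sums and applications*, Ann. of Math. (2) 186
(2017) 413–500 [KowalskiMichelSawin2017] (held text = arXiv:1511.01636; statements read on chunk p0003 of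
`lit read paper:arxiv-1511.01636`: definition of `Kl_k` L30–36, Theorem 1.1 L85–103, Remark 1.2 L105–124, Theorem 1.3
L131–152). The paper's hyper-Kloosterman sum is, «for `k ≥ 2` and `a ∈ (ℤ/qℤ)^×`,
`Kl_k(a;q) = q^{-(k-1)/2} Σ_{x₁,…,x_k ∈ ℤ/qℤ, x₁⋯x_k = a} e((x₁+⋯+x_k)/q)`» (p0003:L30–36) — i.e. EXACTLY the tree's
`Literature.NumberTheory.GaussSums.hyperKloosterman k e(·/q) a` (`GaussSumMonomialFourier.lean`: the sum over ALL tuples in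
`ℤ/qℤ` with product `a`) divided by `q^{(k−1)/2}`; `[×c]*Kl_k` is `a ↦ Kl_k(ca;q)` and
`B(K, α, β) = Σ_m Σ_n α_m β_n K(mn)` ((1.1), p0003:L9).

The companion file `BilinearKloostermanSumsPrimeModulus.lean` (seat ls-Blen-typer-1, cell landau-siegel §B) typed
Theorems 1.1/1.3 at `k = 2` over the classical Kloosterman sum (`kl₂ p a = S(1,a;p)/√p`) and recorded
`-- TODO(general form): … hyper-Kloosterman sums Kl_k, k ≥ 3 (KMS17) — needs … vocabulary`. The vocabulary now exists,
so THIS FILE types the two theorems for EVERY `k ≥ 2` verbatim (`kowalskiMichelSawin2017_theorem11_hyper`,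
`kowalskiMichelSawin2017_theorem13_hyper`; named facts, statements only, implied constant depending on `k` and `ε` as
printed), defines the normalised sum `klHyper k q a`, and PROVES the rank-2 bridge `hyperKloosterman_two_eq_kloostermanSum`
/ `klHyper_two_eq_kl₂` (for a unit `a`: the pairs `x₁x₂ = a` are `(x, a x⁻¹)`, `x` a unit) and the consistency
`kowalskiMichelSawin2017_theorem11_of_hyper : …_hyper → kowalskiMichelSawin2017_theorem11` (in the ranges of Theorem 1.1
every argument `cmn` is a unit mod `q`), so the two typings agree where both speak.

## Why here (cell landau-siegel §D, card `z-degree-toeplitz-band`, crux K1″ why-fail (iii))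

The ψ-graded degree-2 table of the card (`KnifeEdge.TauTwoLivePsiZhang`, `KnifeEdgeLenZDegreePsi.lean`) is, after Zhang's
§8 reflection and the family Gauss moment (`KnifeEdgeLenZDegreeConversion.familyGaussMoment_holds`: the family sum meets
`τ(ψ̄)³`, hence `Kl₃`), a bilinear form `Σ_g Σ_r d₃(g)(μ∗χb)(r)·Kl₃(g·r·n̄; p)` to the PRIME modulus `p ∼ P`
(author's F2-conversion note 2026-08-27T02:18:20Z §3): its diagonal `{hn = r}` is the recipe's exact class, and the
wrap-around must CANCEL — «a bilinear-Kloosterman problem … In-print technology for such forms below the Pólya–Vinogradov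
range: Kowalski–Michel–Sawin Thm 1.1 (type II) and Thm 1.3 (type I)» [corpus:paper:arxiv-1511.01636 p3]. These are the
named in-print inputs of the crux's why-fail (iii) — box-wise coverage only (the note's uncovered boxes `{g < p^{1/2},
p < r < P²}` etc. are NOT claimed covered by anything here). «The programme SEARCHES and TYPES; no claim about
Landau–Siegel zeros, Theorems 1–2 of arXiv:2211.02515 or a repaired Margin232 until a kernel theorem says so.»

Deliberately NOT here: Deligne's `|Kl_k(a;q)| ≤ k^{ω(q)}` (p0003:L38; not in the tree for `k ≥ 3`), Remark 1.2 (1.3)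
(Pólya–Vinogradov-type bound, cited to [FKM2]), Theorems 1.5/1.7 (applications), the sequel arXiv:1802.09849
(general `Kl_k`-type trace functions, wider type I range).
`-- TODO(general form): KMS17 is proved for [×c]*Kl_k only; the sequel (Kowalski–Michel–Sawin, arXiv:1802.09849)
treats general sheaves — needs ℓ-adic-sheaf vocabulary.`

## References
* E. Kowalski, Ph. Michel, W. Sawin, Ann. of Math. (2) 186 (2017), 413–500; arXiv:1511.01636, §1.1 (definition of
  `Kl_k`), Thm 1.1, Rem 1.2, Thm 1.3. [cite: KowalskiMichelSawin2017, §1.1, Theorem 1.1, Theorem 1.3]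
* N. M. Katz, *Gauss Sums, Kloosterman Sums, and Monodromy Groups* (1988), Ch. 4 §4.0 (tree `GaussSumMonomialFourier`).
-/

noncomputable section

open scoped Classical
open Finset

namespace Literature.NumberTheory.LFunctions

open Literature.NumberTheory.GaussSums

/-! ### The normalised hyper-Kloosterman sum `Kl_k(a;q)` and the rank-2 bridge (proved) -/

/-- **KMS's normalised hyper-Kloosterman sum** `Kl_k(a;q) = q^{-(k-1)/2} Σ_{x₁⋯x_k = a, xᵢ ∈ ℤ/qℤ} e((x₁+⋯+x_k)/q)`
(arXiv:1511.01636 §1.1, p0003:L30–36), over the tree's un-normalised `GaussSums.hyperKloosterman k e(·/q) a`.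
[cite: KowalskiMichelSawin2017, §1.1 (definition of Kl_k)] -/
def klHyper (k q : ℕ) [NeZero q] (a : ZMod q) : ℂ :=
  hyperKloosterman k (ZMod.stdAddChar (N := q)) a / (((q : ℝ) ^ (((k : ℝ) - 1) / 2) : ℝ) : ℂ)

/-- Unfolding `klHyper`. [cite: KowalskiMichelSawin2017, §1.1 (definition of Kl_k)] -/
theorem klHyper_def (k q : ℕ) [NeZero q] (a : ZMod q) :
    klHyper k q a = hyperKloosterman k (ZMod.stdAddChar (N := q)) a / (((q : ℝ) ^ (((k : ℝ) - 1) / 2) : ℝ) : ℂ) :=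
  rfl

/-- **Rank 2 is the classical Kloosterman sum (proved):** for a unit `a ∈ ℤ/qℤ`,
`Σ_{x₁x₂ = a} ψ(x₁ + x₂) = S_ψ(1, a; q) = Σ_{x ∈ (ℤ/qℤ)ˣ} ψ(x + a x⁻¹)` — the pairs with product `a` are `(x, a x⁻¹)`
with `x` a unit. (Tree `kloostermanSum q 1 a` is this sum for `ψ = e(·/q)`.) [cite: KowalskiMichelSawin2017, §1.1 (definition of Kl_k), k = 2] -/
theorem hyperKloosterman_two_eq_kloostermanSum (q : ℕ) [NeZero q] {a : ZMod q} (ha : IsUnit a) :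
    hyperKloosterman 2 (ZMod.stdAddChar (N := q)) a = kloostermanSum q 1 a := by
  classical
  unfold hyperKloosterman kloostermanSum
  rw [sum_filter]
  rw [← (finTwoArrowEquiv (ZMod q)).symm.sum_comp]
  simp only [finTwoArrowEquiv_symm_apply, Fin.prod_univ_two, Fin.sum_univ_two, Matrix.cons_val_zero,
    Matrix.cons_val_one]
  rw [Fintype.sum_prod_type]
  refine sum_congr rfl fun x _ => ?_
  by_cases hx : IsUnit x
  · rw [if_pos hx, one_mul]
    have hkey : ∀ y : ZMod q, x * y = a ↔ y = a * x⁻¹ := by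
      intro y
      constructor
      · rintro rfl
        rw [mul_comm x y, mul_assoc, ZMod.mul_inv_of_unit x hx, mul_one]
      · rintro rfl
        rw [mul_comm a, ← mul_assoc, ZMod.mul_inv_of_unit x hx, one_mul]
    simp_rw [hkey]
    rw [sum_ite_eq' univ (a * x⁻¹), if_pos (mem_univ _)]
  · rw [if_neg hx]
    refine sum_eq_zero fun y _ => ?_
    rw [if_neg]
    intro hxy
    exact hx (isUnit_of_dvd_unit (Dvd.intro y hxy) ha)

/-- **Rank-2 bridge to the companion file (proved):** for a unit `a`, `klHyper 2 q a = kl₂ q a` (`q^{(2−1)/2} = √q`).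
[cite: KowalskiMichelSawin2017, §1.1 (definition of Kl_k), k = 2] -/
theorem klHyper_two_eq_kl₂ (q : ℕ) [NeZero q] {a : ZMod q} (ha : IsUnit a) : klHyper 2 q a = kl₂ q a := by
  rw [klHyper_def, kl₂_def, hyperKloosterman_two_eq_kloostermanSum q ha, Real.sqrt_eq_rpow]
  norm_num

/-! ### Kowalski–Michel–Sawin 2017, Theorems 1.1 and 1.3 for every rank `k ≥ 2` (named facts, statements only) -/

/-- **Kowalski–Michel–Sawin 2017, Theorem 1.1 (general bilinear forms), every `k ≥ 2`.** As printed
(arXiv:1511.01636 §1.2, p0003:L85–103): «Let `q` be a prime. Let `c` be an integer coprime to `q`. Let `M` and `N` be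
real numbers such that `1 ≤ M ≤ Nq^{1/4}`, `q^{1/4} < MN < q^{5/4}`. Let `𝒩 ⊂ [1, q−1]` be an interval of length `⌊N⌋`
and let `α = (α_m)_{m ≤ M}` and `β = (β_n)_{n ∈ 𝒩}` be sequences of complex numbers. For any `ε > 0`, we have
`B([×c]*Kl_k, α, β) ≪ q^ε ‖α‖₂‖β‖₂ (MN)^{1/2} (M^{-1/2} + (MN)^{-3/16} q^{11/64})` where the implied constant depend only
on `k` and `ε`.» Same binders as the companion's `k = 2` typing (`𝒩 = {n₀,…,n₀+⌊N⌋−1}`, `1 ≤ n₀`, `n₀ + ⌊N⌋ ≤ q`;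
`1 ≤ m ≤ ⌊M⌋`; every argument `cmn` is then a unit mod `q`). Non-trivial for `M = N ≥ q^{11/24}` (Remark 1.2).
Status: theorem-in-print. Cell landau-siegel §D use: the named in-print input (box-wise) for the wrap-around of the
ψ-graded degree-2 table (`Kl₃`, `k = 3`). [cite: KowalskiMichelSawin2017, Theorem 1.1] -/
def kowalskiMichelSawin2017_theorem11_hyper : Prop :=
  ∀ k : ℕ, 2 ≤ k → ∀ ε : ℝ, 0 < ε → ∃ C : ℝ, 0 < C ∧
    ∀ (q : ℕ) [Fact q.Prime] (c : ℤ), IsCoprime c (q : ℤ) →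
    ∀ (M N : ℝ), 1 ≤ M → M ≤ N * (q : ℝ) ^ (1 / 4 : ℝ) →
      (q : ℝ) ^ (1 / 4 : ℝ) < M * N → M * N < (q : ℝ) ^ (5 / 4 : ℝ) →
    ∀ (n₀ : ℕ), 1 ≤ n₀ → n₀ + ⌊N⌋₊ ≤ q →
    ∀ (α β : ℕ → ℂ),
      ‖∑ m ∈ Icc 1 ⌊M⌋₊, ∑ n ∈ Ico n₀ (n₀ + ⌊N⌋₊),
          α m * β n * klHyper k q ((c : ZMod q) * (m : ZMod q) * (n : ZMod q))‖ ≤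
        C * (q : ℝ) ^ ε * Real.sqrt (∑ m ∈ Icc 1 ⌊M⌋₊, ‖α m‖ ^ 2) *
          Real.sqrt (∑ n ∈ Ico n₀ (n₀ + ⌊N⌋₊), ‖β n‖ ^ 2) * (M * N) ^ (1 / 2 : ℝ) *
          (M ^ (-(1 / 2 : ℝ)) + (M * N) ^ (-(3 / 16 : ℝ)) * (q : ℝ) ^ (11 / 64 : ℝ))

/-- **Kowalski–Michel–Sawin 2017, Theorem 1.3 (special bilinear forms, «type I»), every `k ≥ 2`.** As printed
(arXiv:1511.01636 §1.2, p0003:L131–152): «Let `q` be a prime number. Let `c` be an integer coprime to `q`. Let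
`M, N ≥ 1` be such that `1 ≤ M ≤ N²`, `N < q`, `MN < q^{3/2}`. Let `α = (α_m)_{m ≤ M}` be a sequence of complex numbers
bounded by `1`, and let `𝒩 ⊂ [1, q−1]` be an interval of length `⌊N⌋`. For any `ε > 0`, we have
`B([×c]*Kl_k, α, 1_𝒩) ≪ q^ε ‖α‖₁^{1/2}‖α‖₂^{1/2} M^{1/4} N (M²N⁵/q³)^{-1/12}`, where the implied constant depend only on
`k` and `ε`.» Binders as in the companion's `k = 2` typing (for the `≤ M/q` multiples of `q` among the `m` the argument
is `0`, where `klHyper` takes the value of the all-tuples sum — immaterial at this precision, as there).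
Non-trivial for `M = N ≥ q^{3/7}` (Remark 1.4 (1)). Status: theorem-in-print. [cite: KowalskiMichelSawin2017, Theorem 1.3] -/
def kowalskiMichelSawin2017_theorem13_hyper : Prop :=
  ∀ k : ℕ, 2 ≤ k → ∀ ε : ℝ, 0 < ε → ∃ C : ℝ, 0 < C ∧
    ∀ (q : ℕ) [Fact q.Prime] (c : ℤ), IsCoprime c (q : ℤ) →
    ∀ (M N : ℝ), 1 ≤ M → 1 ≤ N → M ≤ N ^ 2 → N < q → M * N < (q : ℝ) ^ (3 / 2 : ℝ) →
    ∀ (α : ℕ → ℂ), (∀ m : ℕ, ‖α m‖ ≤ 1) →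
    ∀ (n₀ : ℕ), 1 ≤ n₀ → n₀ + ⌊N⌋₊ ≤ q →
      ‖∑ m ∈ Icc 1 ⌊M⌋₊, α m * ∑ n ∈ Ico n₀ (n₀ + ⌊N⌋₊),
          klHyper k q ((c : ZMod q) * (m : ZMod q) * (n : ZMod q))‖ ≤
        C * (q : ℝ) ^ ε * (∑ m ∈ Icc 1 ⌊M⌋₊, ‖α m‖) ^ (1 / 2 : ℝ) *
          (Real.sqrt (∑ m ∈ Icc 1 ⌊M⌋₊, ‖α m‖ ^ 2)) ^ (1 / 2 : ℝ) * M ^ (1 / 4 : ℝ) * N *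
          (M ^ 2 * N ^ 5 / (q : ℝ) ^ 3) ^ (-(1 / 12 : ℝ))

/-! ### Consistency with the companion's `k = 2` typing (proved) -/

/-- In the ranges of Theorem 1.1 the `m`-variable stays below `q`: `M ≤ Nq^{1/4}` and `MN < q^{5/4}` give
`M² < q^{3/2}`, so `M < q`. [cite: KowalskiMichelSawin2017, Theorem 1.1] -/
theorem lt_of_typeII_ranges {q : ℕ} (hq : 2 ≤ q) {M N : ℝ} (h1 : 1 ≤ M) (h2 : M ≤ N * (q : ℝ) ^ (1 / 4 : ℝ))
    (h4 : M * N < (q : ℝ) ^ (5 / 4 : ℝ)) : M < q := by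
  have hq0 : (0 : ℝ) < q := by exact_mod_cast (lt_of_lt_of_le (by norm_num) hq)
  have hq1 : (1 : ℝ) ≤ q := by exact_mod_cast (le_trans (by norm_num) hq)
  have hM0 : 0 < M := lt_of_lt_of_le one_pos h1
  have hq14 : 0 < (q : ℝ) ^ (1 / 4 : ℝ) := Real.rpow_pos_of_pos hq0 _
  have hsq : M * M < (q : ℝ) ^ (3 / 2 : ℝ) := by
    calc M * M ≤ M * (N * (q : ℝ) ^ (1 / 4 : ℝ)) := by gcongr
      _ = M * N * (q : ℝ) ^ (1 / 4 : ℝ) := by ring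
      _ < (q : ℝ) ^ (5 / 4 : ℝ) * (q : ℝ) ^ (1 / 4 : ℝ) := by gcongr
      _ = (q : ℝ) ^ (3 / 2 : ℝ) := by rw [← Real.rpow_add hq0]; norm_num
  have hq32 : (q : ℝ) ^ (3 / 2 : ℝ) ≤ (q : ℝ) ^ (2 : ℝ) :=
    Real.rpow_le_rpow_of_exponent_le hq1 (by norm_num)
  have : M * M < (q : ℝ) * q := by
    calc M * M < (q : ℝ) ^ (3 / 2 : ℝ) := hsq
      _ ≤ (q : ℝ) ^ (2 : ℝ) := hq32
      _ = (q : ℝ) * q := by rw [Real.rpow_two, sq]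
  exact (mul_self_lt_mul_self_iff hM0.le hq0.le).mpr this

/-- A natural number strictly between `0` and the prime `q` is a unit mod `q`. [folklore] -/
private theorem isUnit_natCast_of_lt {q : ℕ} [Fact q.Prime] {m : ℕ} (h0 : 1 ≤ m) (hq : m < q) : IsUnit (m : ZMod q) := by
  rw [ZMod.isUnit_iff_coprime]
  exact (Nat.coprime_of_lt_prime (by omega) hq Fact.out).symm

/-- **The every-`k` typing implies the companion's `k = 2` typing (proved):** in the ranges of Theorem 1.1 every
argument `c·m·n` is a unit mod `q` (`c` coprime, `1 ≤ m ≤ ⌊M⌋ < q`, `n ∈ 𝒩 ⊂ [1, q−1]`), where `klHyper 2 = kl₂`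
(`klHyper_two_eq_kl₂`). [cite: KowalskiMichelSawin2017, Theorem 1.1] -/
theorem kowalskiMichelSawin2017_theorem11_of_hyper (h : kowalskiMichelSawin2017_theorem11_hyper) :
    kowalskiMichelSawin2017_theorem11 := by
  intro ε hε
  obtain ⟨C, hC, hb⟩ := h 2 le_rfl ε hε
  refine ⟨C, hC, fun q _ c hc M N h1 h2 h3 h4 n₀ hn₀ hNq α β => ?_⟩
  have hq2 : 2 ≤ q := (Fact.out : q.Prime).two_le
  have hMq : M < q := lt_of_typeII_ranges hq2 h1 h2 h4
  have hcu : IsUnit ((c : ℤ) : ZMod q) := (ZMod.coe_int_isUnit_iff_isCoprime c q).mpr hc.symm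
  have key : ∀ m ∈ Icc 1 ⌊M⌋₊, ∀ n ∈ Ico n₀ (n₀ + ⌊N⌋₊),
      α m * β n * kl₂ q ((c : ZMod q) * (m : ZMod q) * (n : ZMod q)) =
        α m * β n * klHyper 2 q ((c : ZMod q) * (m : ZMod q) * (n : ZMod q)) := by
    intro m hm n hn
    rw [mem_Icc] at hm
    rw [mem_Ico] at hn
    have hmq : m < q := by
      have : (m : ℝ) ≤ M := le_trans (by exact_mod_cast hm.2) (Nat.floor_le (by linarith))
      exact_mod_cast lt_of_le_of_lt this hMq
    have hmu : IsUnit ((m : ℕ) : ZMod q) := isUnit_natCast_of_lt hm.1 hmq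
    have hnu : IsUnit ((n : ℕ) : ZMod q) := isUnit_natCast_of_lt (le_trans hn₀ hn.1) (by omega)
    rw [klHyper_two_eq_kl₂ q ((hcu.mul hmu).mul hnu)]
  rw [sum_congr rfl fun m hm => sum_congr rfl fun n hn => key m hm n hn]
  exact hb q c hc M N h1 h2 h3 h4 n₀ hn₀ hNq α β

/-! ### Part 2 — Deligne's bound `|Kl_k(a;q)| ≤ k` at a prime (named fact as cited by KMS §1.1; `k = 2` PROVED from Weil) -/

/-- **Deligne's bound for hyper-Kloosterman sums (named fact, as cited in KMS §1.1, p0003:L38):** «A deep result of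
Deligne shows that `|Kl_k(a;q)| ≤ k^{ω(q)}` for all `a ∈ (ℤ/qℤ)^×`» — typed at a PRIME `q` (`ω(q) = 1`): for every
`k ≥ 2` and every unit `a`, `‖klHyper k q a‖ ≤ k`, i.e. `|Σ_{x₁⋯x_k = a} e((x₁+⋯+x_k)/q)| ≤ k·q^{(k−1)/2}` (Deligne,
SGA 4½ «Sommes trig.» §7; Katz 1988 Thm 4.1.1 — neither held; the printed locus cited is KMS). Status:
theorem-in-print; `k = 2` is Weil's bound, PROVED below (`deligne_hyperKloosterman_bound_two`). Cell landau-siegel §D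
use: the «trivial bound» currency for the `Kl₃` wrap-around (author's F2 note §3: «Trivially (Deligne `|Kl₃| ≤ 3p`)
`E_p ≪ p²t₀³·polylog` against the main-term currency `≍ p`»). [cite: KowalskiMichelSawin2017, §1.1 (Deligne's bound |Kl_k(a;q)| ≤ k^{ω(q)})] -/
def deligne_hyperKloosterman_bound : Prop :=
  ∀ k : ℕ, 2 ≤ k → ∀ (q : ℕ) [Fact q.Prime] (a : ZMod q), IsUnit a → ‖klHyper k q a‖ ≤ k

/-- **The `k = 2` case of Deligne's bound is Weil's bound (proved):** `‖klHyper 2 p a‖ ≤ 2` for a unit `a` and `p`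
prime — `klHyper_two_eq_kl₂` and the companion's `norm_kl₂_le_two` (tree `norm_kloostermanSum_one_prime_le`,
`‖S(1,a;p)‖ ≤ 2√p`). [cite: KowalskiMichelSawin2017, §1.1 (Deligne's bound), k = 2, q prime] -/
theorem deligne_hyperKloosterman_bound_two {p : ℕ} [Fact p.Prime] {a : ZMod p} (ha : IsUnit a) :
    ‖klHyper 2 p a‖ ≤ 2 := by
  rw [klHyper_two_eq_kl₂ p ha]
  exact norm_kl₂_le_two a

/-- The trivial bound it feeds (proved from the named fact): for a unit `a`, `‖Σ_{x₁⋯x_k = a} e((x₁+⋯+x_k)/p)‖ ≤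
k·p^{(k−1)/2}` — the un-normalised form used in the card's size bookkeeping (`|Kl₃| ≤ 3p`).
[cite: KowalskiMichelSawin2017, §1.1 (Deligne's bound |Kl_k(a;q)| ≤ k^{ω(q)})] -/
theorem norm_hyperKloosterman_le_of_deligne (h : deligne_hyperKloosterman_bound) {k : ℕ} (hk : 2 ≤ k) {p : ℕ}
    [Fact p.Prime] {a : ZMod p} (ha : IsUnit a) :
    ‖hyperKloosterman k (ZMod.stdAddChar (N := p)) a‖ ≤ k * (p : ℝ) ^ (((k : ℝ) - 1) / 2) := by
  have hp : (0 : ℝ) < (p : ℝ) ^ (((k : ℝ) - 1) / 2) :=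
    Real.rpow_pos_of_pos (by exact_mod_cast (Fact.out : p.Prime).pos) _
  have := h k hk p a ha
  rw [klHyper_def, norm_div, Complex.norm_real, Real.norm_eq_abs, abs_of_pos hp, div_le_iff₀ hp] at this
  exact this

/-! ### Part 3 — consistency with the companion's `k = 2` typing of Theorem 1.3 (proved) -/

/-- In the ranges of Theorem 1.3 the `m`-variable also stays below `q`: `M ≤ N²` and `MN < q^{3/2}` give
`M^{3/2} ≤ MN < q^{3/2}`, so `M < q` (hence every `1 ≤ m ≤ ⌊M⌋` is a unit mod `q`, and the companion's remark on
multiples of `q` among the `m` is vacuous). [cite: KowalskiMichelSawin2017, Theorem 1.3] -/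
theorem lt_of_typeI_ranges {q : ℕ} {M N : ℝ} (h1 : 1 ≤ M) (hN : 1 ≤ N) (h2 : M ≤ N ^ 2)
    (h4 : M * N < (q : ℝ) ^ (3 / 2 : ℝ)) : M < q := by
  have hM0 : 0 < M := lt_of_lt_of_le one_pos h1
  have hN0 : 0 < N := lt_of_lt_of_le one_pos hN
  have hq0 : (0 : ℝ) ≤ q := Nat.cast_nonneg q
  -- √M ≤ N, so M·√M ≤ M·N < q^{3/2} = q·√q
  have hsM : Real.sqrt M ≤ N := by
    rw [Real.sqrt_le_left hN0.le] at *
    · exact h2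
  have h32 : (q : ℝ) ^ (3 / 2 : ℝ) = q * Real.sqrt q := by
    rw [Real.sqrt_eq_rpow, ← Real.rpow_one_add' hq0 (by norm_num)]
    norm_num
  have hlt : M * Real.sqrt M < q * Real.sqrt q := by
    calc M * Real.sqrt M ≤ M * N := by gcongr
      _ < (q : ℝ) ^ (3 / 2 : ℝ) := h4
      _ = q * Real.sqrt q := h32
  by_contra hle
  have hle' : (q : ℝ) ≤ M := not_lt.mp hle
  have : (q : ℝ) * Real.sqrt q ≤ M * Real.sqrt M :=
    mul_le_mul hle' (Real.sqrt_le_sqrt hle') (Real.sqrt_nonneg _) hM0.le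
  linarith

/-- **The every-`k` typing of Theorem 1.3 implies the companion's `k = 2` typing (proved):** in its ranges every
argument `c·m·n` is a unit mod `q` (`lt_of_typeI_ranges`), where `klHyper 2 = kl₂`. [cite: KowalskiMichelSawin2017, Theorem 1.3] -/
theorem kowalskiMichelSawin2017_theorem13_of_hyper (h : kowalskiMichelSawin2017_theorem13_hyper) :
    kowalskiMichelSawin2017_theorem13 := by
  intro ε hε
  obtain ⟨C, hC, hb⟩ := h 2 le_rfl ε hε
  refine ⟨C, hC, fun q _ c hc M N h1 hN h2 h3 h4 α hα n₀ hn₀ hNq => ?_⟩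
  have hMq : M < q := lt_of_typeI_ranges h1 hN h2 h4
  have hcu : IsUnit ((c : ℤ) : ZMod q) := (ZMod.coe_int_isUnit_iff_isCoprime c q).mpr hc.symm
  have key : ∀ m ∈ Icc 1 ⌊M⌋₊, ∀ n ∈ Ico n₀ (n₀ + ⌊N⌋₊),
      kl₂ q ((c : ZMod q) * (m : ZMod q) * (n : ZMod q)) = klHyper 2 q ((c : ZMod q) * (m : ZMod q) * (n : ZMod q)) := by
    intro m hm n hn
    rw [mem_Icc] at hm
    rw [mem_Ico] at hn
    have hmq : m < q := by
      have : (m : ℝ) ≤ M := le_trans (by exact_mod_cast hm.2) (Nat.floor_le (by linarith))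
      exact_mod_cast lt_of_le_of_lt this hMq
    have hmu : IsUnit ((m : ℕ) : ZMod q) := isUnit_natCast_of_lt hm.1 hmq
    have hnu : IsUnit ((n : ℕ) : ZMod q) := isUnit_natCast_of_lt (le_trans hn₀ hn.1) (by omega)
    rw [klHyper_two_eq_kl₂ q ((hcu.mul hmu).mul hnu)]
  rw [sum_congr rfl fun m hm => congrArg (α m * ·) (sum_congr rfl fun n hn => key m hm n hn)]
  exact hb q c hc M N h1 hN h2 h3 h4 α hα n₀ hn₀ hNq

/-! ### Part 4 — rank 2 at the ZERO argument (prime modulus): `Σ_{x₁x₂ = 0} ψ(x₁+x₂) = −1 = S(1,0;p)`, so at a prime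
`klHyper 2 p = kl₂ p` at EVERY argument (the two typings of `Kl₂` agree identically, not only on units) -/

/-- **`Σ_{x₁x₂ = 0} e((x₁+x₂)/p) = −1` at a prime (proved):** the pairs with product `0` are `{x₁ = 0} ∪ {x₂ = 0}`; each line
sums the non-trivial character to `0`, the double-counted origin contributes `e(0) = 1`, so the total is `0 + 0 − 1`;
equivalently `Σ_{x₁ ≠ 0} e(x₁/p) = −1 = S(1,0;p)` (`kloostermanSum_one_zero`). [cite: KowalskiMichelSawin2017, §1.1 (definition of Kl_k), k = 2, a = 0] -/
theorem hyperKloosterman_two_zero {p : ℕ} [Fact p.Prime] :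
    hyperKloosterman 2 (ZMod.stdAddChar (N := p)) 0 = -1 := by
  classical
  unfold hyperKloosterman
  rw [sum_filter, ← (finTwoArrowEquiv (ZMod p)).symm.sum_comp]
  simp only [finTwoArrowEquiv_symm_apply, Fin.prod_univ_two, Fin.sum_univ_two, Matrix.cons_val_zero,
    Matrix.cons_val_one]
  rw [Fintype.sum_prod_type]
  -- inner sum at fixed x: if x = 0 it is Σ_y ψ(y) = 0, else only y = 0 contributes ψ(x)
  have inner : ∀ x : ZMod p, (∑ y : ZMod p, if x * y = 0 then (ZMod.stdAddChar (x + y) : ℂ) else 0) =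
      if x = 0 then 0 else (ZMod.stdAddChar x : ℂ) := by
    intro x
    by_cases hx : x = 0
    · subst hx
      simp only [zero_mul, if_true, zero_add]
      exact sum_stdAddChar_eq_zero
    · rw [if_neg hx]
      have hkey : ∀ y : ZMod p, (x * y = 0) ↔ y = 0 := fun y => by
        rw [mul_eq_zero]; exact ⟨fun h => h.resolve_left hx, Or.inr⟩
      simp_rw [hkey]
      rw [sum_ite_eq' univ (0 : ZMod p), if_pos (mem_univ _), add_zero]
  simp_rw [inner]
  have h : ∀ x : ZMod p, (if x = 0 then (0 : ℂ) else (ZMod.stdAddChar x : ℂ)) =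
      (ZMod.stdAddChar x : ℂ) - if x = 0 then (1 : ℂ) else 0 := by
    intro x
    by_cases hx : x = 0
    · subst hx; simp
    · rw [if_neg hx, if_neg hx, sub_zero]
  simp_rw [h]
  rw [Finset.sum_sub_distrib, sum_stdAddChar_eq_zero, Finset.sum_ite_eq' Finset.univ (0 : ZMod p)]
  simp

/-- **At a prime, rank 2 IS the classical Kloosterman sum at every argument (proved):** `Σ_{x₁x₂ = a} e((x₁+x₂)/p) = S(1,a;p)`
for all `a ∈ ℤ/pℤ` (units: `hyperKloosterman_two_eq_kloostermanSum`; `a = 0`: both are `−1`).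
[cite: KowalskiMichelSawin2017, §1.1 (definition of Kl_k), k = 2] -/
theorem hyperKloosterman_two_eq_kloostermanSum_prime {p : ℕ} [Fact p.Prime] (a : ZMod p) :
    hyperKloosterman 2 (ZMod.stdAddChar (N := p)) a = kloostermanSum p 1 a := by
  by_cases ha : a = 0
  · subst ha
    rw [hyperKloosterman_two_zero, kloostermanSum_one_zero]
  · exact hyperKloosterman_two_eq_kloostermanSum p (isUnit_iff_ne_zero.mpr ha)

/-- **At a prime, `klHyper 2 p = kl₂ p` identically (proved).** [cite: KowalskiMichelSawin2017, §1.1 (definition of Kl_k), k = 2] -/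
theorem klHyper_two_eq_kl₂_prime {p : ℕ} [Fact p.Prime] (a : ZMod p) : klHyper 2 p a = kl₂ p a := by
  rw [klHyper_def, kl₂_def, hyperKloosterman_two_eq_kloostermanSum_prime a, Real.sqrt_eq_rpow]
  norm_num

end Literature.NumberTheory.LFunctions

end
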